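import Literature.AlgebraicGeometry.Resolution.CurveCentreNearPointDimension
import Literature.AlgebraicGeometry.Resolution.NearPointsRational
import Literature.AlgebraicGeometry.Resolution.NearPointsPointCentreLine
import Literature.AlgebraicGeometry.Resolution.NearPointsTau
import Literature.AlgebraicGeometry.Resolution.NearChainStep
import HarnessLib

/-!
# The curve step at a `τ = 1` point, scheme → ring: chart data at the near point for an ADAPTED system of parameters (CoP1, Lemma 4.3 (4))

Topic: `Literature/AlgebraicGeometry/Resolution`. [CoP1] = Cossart–Piltant, J. Algebra 320 (2008), Lemma 4.3 (4), proof, p. 9: "we may now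
choose `(y₁, y₂, y₃)` in such a way that `D_x = k(x).Y₂`, with `Y = (y₁, y₂)` … the only point which may be very near `x` is the point
`x′ := (y₁′ = y₁, y₂′ = y₂/y₁, y₃)`". PROVED here (no facts, no definitions), as the ring-interface shape the `τ = 1` chain engine consumes
(res-hironaka inputs cell, T1 skeleton stub κ): for the blowing up `π` of a regular equimultiple curve centre `Y`, a point `x` of `Y` with regular
local ring of embedding dimension `3`, a regular system of parameters `c = (z, u, v)` with `𝓘_{Y,x} = (z, u)`, `τ_x(J, μ) = 1` and `c` ADAPTED to the
directrix `z` (`IsAdapted` at the indices `1, 2`), and a near point `x′` over `x`: there is `w ∈ 𝒪_{X′,x′}` with `𝓘_Y𝒪_{X′,x′} = (φ u)`, `φ z = φ u · w`,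
`(w, φ u, φ v)` a regular system of parameters of `𝒪_{X′,x′}`, the residue field of `x′` reached from `𝒪_{X,x}`, and the weak-transform clause
`φ(u)^μ g ∈ J𝒪 ⇒ g ∈ J′`. Ingredients (tree): `IsBlowup.exists_chart_rsop_of_isNear_curve_of_adapted` (the chart presentation and the regular system
`(c_j, e_l, w)`), `IsBlowup.residue_comp_stalkMap_surjective_of_isNear` (rationality), `proj_mem_directrix_of_hironakaTauAt_eq_one` (adapted ⇒ directrix
`= k·Z`), `initialForms_comp_map_rename_le` (forms of the pair are forms of the triple).

* `initialForms_pair_adapted_of_isAdapted` — adaptedness of the triple at `1, 2` and `τ = 1` make every initial form of `J` in the pair `(z, u)` a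
  multiple of `Z^μ`;
* `IsBlowup.exists_curveStepData_of_adapted` (at `x′`) and `…_congr` (at a point `q = x′`, for chain bookkeeping).

## Sources
* V. Cossart, O. Piltant, J. Algebra 320 (2008) 1051–1082, Lemma 4.3 (4) and its proof. [CossartPiltant2008]
-/

noncomputable section

open CategoryTheory CategoryTheory.Limits AlgebraicGeometry TopologicalSpace IsLocalRing MvPolynomial

namespace Literature.AlgebraicGeometry.Resolution

universe u

open Scheme.IdealSheafData

/-! ## Adaptedness of the pair from adaptedness of the triple -/

section Ring

variable {R : Type u} [CommRing R] [IsRegularLocalRing R]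

/-- **`τ = 1` and `(z, u, v)` adapted at `1, 2` ⇒ every `μ`-initial form of `J` in the variables of the pair `(z, u)` is a multiple of `Z^μ`.**
[cite: CossartPiltant2008, Lemma 4.3 (4) (proof)] -/
theorem initialForms_pair_adapted_of_isAdapted (c : Fin 3 → R) {J : Ideal R} {μ : ℕ} (hτ : hironakaTauAt c J μ = 1)
    (had : ∀ i, i ≠ 0 → IsAdapted c J μ i) :
    ∀ G ∈ initialForms (c ∘ Fin.castSucc) J μ, ∃ c₀ : ResidueField R, G = MvPolynomial.C c₀ * MvPolynomial.X (0 : Fin 2) ^ μ := by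
  classical
  -- the directrix form is `a · Y_0`
  obtain ⟨ℓ, hℓ0, hℓd, hℓ⟩ := exists_forall_initialForms_eq_of_hironakaTauAt_eq_one c hτ
  have hℓi : ∀ i, i ≠ 0 → ℓ (Pi.single i 1) = 0 := fun i hi => (had i hi).apply_single_eq_zero hℓd
  have hlin : linearFormPoly (ResidueField R) ℓ = MvPolynomial.C (ℓ (Pi.single 0 1)) * MvPolynomial.X 0 := by
    rw [linearFormPoly, Fin.sum_univ_three, hℓi 1 (by decide), hℓi 2 (by decide)]
    simp
  -- forms of the triple
  have htri : ∀ G ∈ initialForms c J μ, ∃ b : ResidueField R, G = MvPolynomial.C b * MvPolynomial.X (0 : Fin 3) ^ μ := by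
    intro G hG
    obtain ⟨b, hb⟩ := hℓ G hG
    refine ⟨b * ℓ (Pi.single 0 1) ^ μ, ?_⟩
    rw [hb, hlin, mul_pow, ← MvPolynomial.C_pow, ← mul_assoc, ← MvPolynomial.C_mul]
  -- forms of the pair are forms of the triple under the renaming `castSucc`
  intro G hG
  have hmem : MvPolynomial.rename (Fin.castSucc : Fin 2 → Fin 3) G ∈ initialForms c J μ :=
    initialForms_comp_map_rename_le c Fin.castSucc J μ ⟨G, hG, rfl⟩
  obtain ⟨b, hb⟩ := htri _ hmem
  refine ⟨b, MvPolynomial.rename_injective (Fin.castSucc : Fin 2 → Fin 3) (Fin.castSucc_injective 2) ?_⟩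
  rw [hb, map_mul, map_pow, MvPolynomial.rename_C, MvPolynomial.rename_X]
  rfl

end Ring

/-! ## The curve step -/

variable {X X' : Scheme.{u}} {π : X' ⟶ X}

/-- **The curve step at a `τ = 1` point, scheme → ring** (at `x′`). `X` regular locally Noetherian, `Y` a regular centre with `ord J = μ` along it
(`μ ≥ 1`), `x = π x′` with regular local ring of embedding dimension `3`, `c = (z, u, v)` a regular system of parameters with `(z, u) = 𝓘_{Y,x}`,
`τ_x(J, μ) = 1`, `c` adapted at `1, 2`, `x′` near. Then `𝓘_Y𝒪_{x′} = (φ u)` and there is a regular system `c′ = (w, φ u, φ v)` of `𝒪_{x′}` with `φ z = φ u · w`, `k(x) → k(x′)` onto,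
and the weak transform's stalk IS the colon `J′_{x′} = (J𝒪_{x′} : φ(u)^μ)` — exactly the input block of the ring-level curve step
`CurveStepPrepared.exists_prepared_label_curveStep` (`h₁ h₀ h₂ hgen′ hψ hJ′def`). [cite: CossartPiltant2008, Lemma 4.3 (4) (proof)] -/
theorem IsBlowup.exists_curveStepData_of_adapted [IsLocallyNoetherian X] [IsLocallyNoetherian X'] (hX : Scheme.IsRegular X)
    {Y : Closeds X} (hreg : Scheme.IsRegular (vanishingIdeal Y).subscheme) (hπ : IsBlowup π (vanishingIdeal Y))
    {J : X.IdealSheafData} {μ : ℕ} (hμ : 1 ≤ μ) (hY : ∀ y ∈ (Y : Set X), idealOrder J y = μ)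
    {x' : X'} [IsRegularLocalRing (X.presheaf.stalk (π x'))]
    (hd : (maximalIdeal (X.presheaf.stalk (π x'))).spanFinrank = 3)
    {c : Fin 3 → X.presheaf.stalk (π x')} (hc : Ideal.span (Set.range c) = maximalIdeal _)
    (hcY : Ideal.span {c 0, c 1} = stalkIdeal (vanishingIdeal Y) (π x'))
    (hτ : stalkTau J (π x') μ = 1) (had : ∀ i, i ≠ 0 → IsAdapted c (stalkIdeal J (π x')) μ i)
    (hnear : IsNear π (vanishingIdeal Y) J μ x') :
    ∃ c' : Fin 3 → X'.presheaf.stalk x',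
      (stalkIdeal (vanishingIdeal Y) (π x')).map (π.stalkMap x').hom = Ideal.span {(π.stalkMap x').hom (c 1)} ∧
      c' 1 = (π.stalkMap x').hom (c 1) ∧
      (π.stalkMap x').hom (c 0) = (π.stalkMap x').hom (c 1) * c' 0 ∧
      c' 2 = (π.stalkMap x').hom (c 2) ∧
      Ideal.span {c' 0, c' 1, c' 2} = maximalIdeal (X'.presheaf.stalk x') ∧
      Function.Surjective (ResidueField.map (π.stalkMap x').hom) ∧
      stalkIdeal (controlledTransform π (vanishingIdeal Y) J μ) x' =
        Submodule.colon ((stalkIdeal J (π x')).map (π.stalkMap x').hom)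
          ({(π.stalkMap x').hom (c 1) ^ μ} : Set (X'.presheaf.stalk x')) := by
  classical
  -- the pair `p = (z, u)` and its completion `w₀ = (v)`
  set p : Fin 2 → X.presheaf.stalk (π x') := c ∘ Fin.castSucc with hp
  have hp0 : p 0 = c 0 := rfl
  have hp1 : p 1 = c 1 := rfl
  have hprange : Set.range p = {c 0, c 1} := by
    ext a
    simp only [Set.mem_range, Set.mem_insert_iff, Set.mem_singleton_iff]
    constructor
    · rintro ⟨i, rfl⟩; fin_cases i; exacts [Or.inl hp0, Or.inr hp1]
    · rintro (rfl | rfl); exacts [⟨0, hp0⟩, ⟨1, hp1⟩]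
  have hpY : Ideal.span (Set.range p) = stalkIdeal (vanishingIdeal Y) (π x') := by rw [hprange, hcY]
  set w₀ : Fin 1 → X.presheaf.stalk (π x') := fun _ => c 2 with hw₀
  have hw₀range : Set.range w₀ = {c 2} := by
    ext a; simp [hw₀]
  have hcrange : Set.range c = {c 0, c 1, c 2} := by
    ext a
    simp only [Set.mem_range, Set.mem_insert_iff, Set.mem_singleton_iff]
    constructor
    · rintro ⟨i, rfl⟩
      fin_cases i
      · exact Or.inl rfl
      · exact Or.inr (Or.inl rfl)
      · exact Or.inr (Or.inr rfl)
    · rintro (h | h | h) <;> exact ⟨_, h.symm⟩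
  have happ' : Set.range (Fin.append p w₀) = Set.range p ∪ Set.range w₀ := by
    ext a
    constructor
    · rintro ⟨i, rfl⟩
      induction i using Fin.addCases with
      | left k => exact Or.inl ⟨k, by simp⟩
      | right k => exact Or.inr ⟨k, by simp⟩
    · rintro (⟨k, rfl⟩ | ⟨k, rfl⟩)
      · exact ⟨Fin.castAdd 1 k, by simp⟩
      · exact ⟨Fin.natAdd 2 k, by simp⟩
  have happ : Set.range (Fin.append p w₀) = Set.range c := by
    rw [happ', hprange, hw₀range, hcrange, Set.union_singleton, Set.insert_comm (c 2) (c 0), Set.pair_comm (c 2) (c 1)]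
  have hz : Ideal.span (Set.range (Fin.append p w₀)) = maximalIdeal _ := by rw [happ, hc]
  have hdim : ringKrullDim (X.presheaf.stalk (π x')) = 3 := by
    have h := (isRegularLocalRing_iff (X.presheaf.stalk (π x'))).mp inferInstance
    rw [hd] at h; exact_mod_cast h.symm
  have hpr : IsRsopPart p := by
    refine ⟨inferInstance, 1, w₀, by rw [hdim]; rfl, ?_⟩
    rw [← happ', hz]
  -- the pair is adapted to `Z` (index `l = 0`, chart `j = 1`)
  have hτc : hironakaTauAt c (stalkIdeal J (π x')) μ = 1 := by rw [← stalkTau_eq J (π x') μ hd c hc]; exact hτ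
  have hadapt : ∀ G ∈ initialForms p (stalkIdeal J (π x')) μ, ∃ c₀ : ResidueField (X.presheaf.stalk (π x')),
      G = MvPolynomial.C c₀ * MvPolynomial.X (0 : Fin 2) ^ μ :=
    initialForms_pair_adapted_of_isAdapted c hτc had
  -- the chart presentation at the near point
  obtain ⟨𝔴, χ, hχ, hloc, h𝔴, hel, hreg', hd', hspan', hrel⟩ :=
    hπ.exists_chart_rsop_of_isNear_curve_of_adapted hX hreg hμ hY hpr hpY (1 : Fin 2) (l := 0) (by decide) hadapt hnear w₀ hz
      (by rw [hd])
  haveI := hreg'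
  letI := χ.toAlgebra
  have hCmap : (stalkIdeal (vanishingIdeal Y) (π x')).map (π.stalkMap x').hom = Ideal.span {(π.stalkMap x').hom (c 1)} := by
    rw [← hcY, Ideal.map_span, Set.image_pair]
    have h0 : (π.stalkMap x').hom (c 0) ∈ Ideal.span {(π.stalkMap x').hom (c 1)} := by
      rw [← hp0, ← hp1, hrel]
      exact Ideal.mul_mem_right _ _ (Ideal.mem_span_singleton_self _)
    exact Submodule.span_insert_eq_span h0
  refine ⟨![χ (chartGen p 1 0), (π.stalkMap x').hom (c 1), (π.stalkMap x').hom (c 2)], hCmap, by simp, ?_, by simp, ?_, ?_, ?_⟩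
  · simp only [Matrix.cons_val_zero]
    rw [← hp0, ← hp1]; exact hrel
  · -- the regular system `(e_z, φ u, φ v)` generates `𝔪_{x′}`
    simp only [Matrix.cons_val_zero, Matrix.cons_val_one, Matrix.cons_val_two, Matrix.head_cons, Matrix.tail_cons]
    rw [← hspan']
    have hrange : Set.range (chartFamily p 1 w₀ (X'.presheaf.stalk x') (chartBase p 1) (chartGen p 1)
        fun _ : Fin 1 => (⟨0, by decide⟩ : {i : Fin 2 // i ≠ 1})) =
        {(π.stalkMap x').hom (c 1), χ (chartGen p 1 0), (π.stalkMap x').hom (c 2)} := by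
      ext a
      rw [← List.mem_ofFn', ofFn_chartFamily]
      simp [RingHom.algebraMap_toAlgebra, hχ, hw₀, hp1]
    rw [hrange, Set.insert_comm (χ (chartGen p 1 0)) ((π.stalkMap x').hom (c 1))]
  · -- `k(x) → k(x′)` is onto
    intro a
    obtain ⟨b, hb⟩ := hπ.residue_comp_stalkMap_surjective_of_isNear hX hreg hμ hY hpr hpY hnear a
    exact ⟨IsLocalRing.residue _ b, by rw [ResidueField.map_residue]; exact hb⟩
  · -- the weak transform's stalk is the colon
    rw [controlledTransform, stalkIdeal_colon, stalkIdeal_pow, stalkIdeal_comap_eq_map_stalkMap, stalkIdeal_comap_eq_map_stalkMap, hCmap,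
      Ideal.span_singleton_pow]
    exact Submodule.colon_span

/-- **The curve step at a `τ = 1` point, scheme → ring, at a point `q = x′`** (chain bookkeeping via `stalkMapCongr`).
[cite: CossartPiltant2008, Lemma 4.3 (4) (proof)] -/
theorem IsBlowup.exists_curveStepData_of_adapted_congr [IsLocallyNoetherian X] [IsLocallyNoetherian X'] (hX : Scheme.IsRegular X)
    {Y : Closeds X} (hreg : Scheme.IsRegular (vanishingIdeal Y).subscheme) (hπ : IsBlowup π (vanishingIdeal Y))
    {J : X.IdealSheafData} {μ : ℕ} (hμ : 1 ≤ μ) (hY : ∀ y ∈ (Y : Set X), idealOrder J y = μ)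
    {x' : X'} [IsRegularLocalRing (X.presheaf.stalk (π x'))]
    (hd : (maximalIdeal (X.presheaf.stalk (π x'))).spanFinrank = 3)
    {c : Fin 3 → X.presheaf.stalk (π x')} (hc : Ideal.span (Set.range c) = maximalIdeal _)
    (hcY : Ideal.span {c 0, c 1} = stalkIdeal (vanishingIdeal Y) (π x'))
    (hτ : stalkTau J (π x') μ = 1) (had : ∀ i, i ≠ 0 → IsAdapted c (stalkIdeal J (π x')) μ i)
    (hnear : IsNear π (vanishingIdeal Y) J μ x') (q : X') (h : q = x') :
    ∃ c' : Fin 3 → X'.presheaf.stalk q,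
      (stalkIdeal (vanishingIdeal Y) (π x')).map (stalkMapCongr π x' q h) = Ideal.span {stalkMapCongr π x' q h (c 1)} ∧
      c' 1 = stalkMapCongr π x' q h (c 1) ∧
      stalkMapCongr π x' q h (c 0) = stalkMapCongr π x' q h (c 1) * c' 0 ∧
      c' 2 = stalkMapCongr π x' q h (c 2) ∧
      Ideal.span {c' 0, c' 1, c' 2} = maximalIdeal (X'.presheaf.stalk q) ∧
      Function.Surjective (ResidueField.map (stalkMapCongr π x' q h)) ∧
      stalkIdeal (controlledTransform π (vanishingIdeal Y) J μ) q =
        Submodule.colon ((stalkIdeal J (π x')).map (stalkMapCongr π x' q h))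
          ({stalkMapCongr π x' q h (c 1) ^ μ} : Set (X'.presheaf.stalk q)) := by
  subst h
  simp only [stalkMapCongr_self]
  exact hπ.exists_curveStepData_of_adapted hX hreg hμ hY hd hc hcY hτ had hnear

end Literature.AlgebraicGeometry.Resolution

end
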